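import Literature.NumberTheory.EllipticCurves.SubgroupSelmerCocycleCriteriaProofs
import Mathlib.Topology.Algebra.OpenSubgroup
import HarnessLib

/-!
# `H¹` of a pro-`p′` piece with `p`-primary coefficients vanishes: a class killed on `I` is killed on
# any compact `N ≥ I` all of whose open subgroups above `I` have index prime to `p`
# (route-free KEY lemma behind «unramified at `ℓ ≠ p` over `ℚ` ⟺ trivial over `ℚ_{∞,w}`», the
# `ℓ ≠ p` step of the EXACT fine control count for crux M = stmt-BirchSwinnertonDyer-19196)

Seat `bsd-potss-rkm` g27 (prover, cell `bsd-potss`), `--supports stmt-BirchSwinnertonDyer-19196 --as helper`;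
closes nothing.  HONEST FRAMING: BSD is not proved by any of this; nothing is booked; pure group
cohomology (no definition, no named fact, no `sorry`).

## What and why

Memo FINDING-19196-rkm-g26 §3b/§5: on the rows of crux M with `W(ℚ_p)[p] = 0` the count clause (c2′)
of the held core package `Kato2004.exists_memberHullZetaCoreInputs` (item 27962) is the EXACT FINE
CONTROL count `#Sel₀(ℚ_∞, W[p^∞])^Γ = #Sel_str(ℚ, W[p^∞])`, whose only non-formal step left after
p659030 is the place-by-place identification at `ℓ ≠ p`: a class of `H¹(ℚ, W[p^∞])` is UNRAMIFIED at
`ℓ` iff its restriction to `Gal(ℚ̄/ℚ_∞) ⊓ D_ℓ = Gal(ℚ̄_ℓ/ℚ_{∞,w})` vanishes.  The non-trivial direction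
is the vanishing of `H¹(Gal(ℚ_ℓ^{nr′}/ℚ_{∞,w}), M^{I_ℓ})` for the pro-`p′` procyclic group
`Gal(ℚ̄_ℓ/ℚ_{∞,w})/I_ℓ ≅ ∏_{q ≠ p} ℤ_q` on `p`-primary coefficients (Greenberg–Vatsal 2000, proof of
Prop. (2.4); Greenberg LNM 1716, proof of Lemma 3.3).  This file proves the abstract statement:

* §0 arithmetic in a `p`-primary abelian group (Bezout);
* §1 **`resOfLe_eq_zero_of_resOfLe_eq_zero_of_coprime_index`** — for a topological group `G`, a
  discrete `p`-primary `G`-module `M` with continuous action, subgroups `I ≤ N ≤ H` with `N` compact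
  such that every subgroup of `N` open in `N` and containing the trace of `I` has index prime to `p`,
  a class `c ∈ H¹(H, M)` with `res_I c = 0` has `res_N c = 0`.  Proof on explicit continuous cocycles
  (`CocycleCriteria.resOfLe_oneCocycleClass_eq_zero_iff`): the `I`-vanishing representative `f` has an
  open zero-locus subgroup `V ≤ N` of `p′`-index `m`; averaging over `N ⧸ V` gives `m·f = -∂S`, and
  `m` acts bijectively on `M`.

The arithmetic instance (`N = Gal(K̄/K_∞) ⊓ D_v`, `I = I_v`, `v ∤ p`, `κ` cyclotomic) is the sibling
`KatoDescentPotSupersingularUnramifiedTrivialOverTower.lean`.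

References: J.-P. Serre, *Galois Cohomology* (1997), I.§2.4 (Cor. of Prop. 9) [SerreGaloisCohomology1997];
J. Neukirch, A. Schmidt, K. Wingberg, *Cohomology of Number Fields* (2008), (1.6.1) [NeukirchSchmidtWingberg2008];
R. Greenberg, V. Vatsal, Invent. Math. 142 (2000), §2 Prop. (2.4) [GreenbergVatsal2000];
R. Greenberg, LNM 1716 (1999), §3 Lemma 3.3 [GreenbergLNM1716].
-/

-- the summit and its single problem are both named `BirchSwinnertonDyer` (registry layout D-0017)
set_option linter.dupNamespace false
set_option autoImplicit false

noncomputable section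

open scoped Classical Pointwise
open Function
open Literature.NumberTheory.EllipticCurves Literature.NumberTheory.GaloisRepresentations

universe u

namespace Summit.BirchSwinnertonDyer.BirchSwinnertonDyer.Theorems.ProPrimeToPVanishing

/-! ## §0 Arithmetic in a `p`-primary abelian group -/

section Arith

variable {A : Type*} [AddCommGroup A]

/-- Bezout for `m` coprime to `p`: `a m + b p^k = 1` in `ℤ`. [folklore] -/
theorem exists_int_combination_eq_one {p m : ℕ} (hm : m.Coprime p) (k : ℕ) :
    ∃ a b : ℤ, a * m + b * (p : ℤ) ^ k = 1 := by
  have h : IsCoprime (m : ℤ) ((p ^ k : ℕ) : ℤ) :=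
    Nat.isCoprime_iff_coprime.mpr (Nat.Coprime.pow_right k hm)
  obtain ⟨a, b, hab⟩ := h
  exact ⟨a, b, by push_cast at hab; linarith⟩

/-- An element of a `p`-primary abelian group killed by an integer coprime to `p` is zero. [folklore] -/
theorem eq_zero_of_coprime_nsmul_eq_zero {p m : ℕ} (hm : m.Coprime p) {x : A}
    (hx : ∃ k : ℕ, p ^ k • x = 0) (hmx : m • x = 0) : x = 0 := by
  obtain ⟨k, hk⟩ := hx
  obtain ⟨a, b, hab⟩ := exists_int_combination_eq_one hm k
  have h1 : (1 : ℤ) • x = (a * m + b * (p : ℤ) ^ k) • x := by rw [hab]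
  rw [one_zsmul, add_zsmul, mul_zsmul, mul_zsmul] at h1
  have h2 : (m : ℤ) • x = 0 := by rw [natCast_zsmul]; exact hmx
  have h3 : ((p : ℤ) ^ k) • x = 0 := by
    rw [show ((p : ℤ) ^ k) = ((p ^ k : ℕ) : ℤ) by push_cast; rfl, natCast_zsmul]; exact hk
  rw [h2, h3, smul_zero, smul_zero, add_zero] at h1
  exact h1

/-- In a `p`-primary abelian group, multiplication by an integer coprime to `p` is onto. [folklore] -/
theorem exists_nsmul_eq_of_coprime {p m : ℕ} (hm : m.Coprime p) (x : A)
    (hx : ∃ k : ℕ, p ^ k • x = 0) : ∃ y : A, m • y = x := by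
  obtain ⟨k, hk⟩ := hx
  obtain ⟨a, b, hab⟩ := exists_int_combination_eq_one hm k
  refine ⟨a • x, ?_⟩
  have h1 : (1 : ℤ) • x = (a * m + b * (p : ℤ) ^ k) • x := by rw [hab]
  rw [one_zsmul, add_zsmul, mul_zsmul, mul_zsmul] at h1
  have h3 : ((p : ℤ) ^ k) • x = 0 := by
    rw [show ((p : ℤ) ^ k) = ((p ^ k : ℕ) : ℤ) by push_cast; rfl, natCast_zsmul]; exact hk
  rw [h3, smul_zero, add_zero, natCast_zsmul, smul_comm] at h1
  exact h1.symm

end Arith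

/-! ## §1 KEY: a class killed on `I` is killed on a compact `N ≥ I` all of whose open subgroups
above `I` have index prime to `p` -/

section Key

variable {G : Type u} [Group G] [TopologicalSpace G] [IsTopologicalGroup G]
  {M : Type u} [AddCommGroup M] [DistribMulAction G M] [TopologicalSpace M] [DiscreteTopology M]

/-- **KEY LEMMA (`H¹` of a pro-`p′` piece with `p`-primary coefficients vanishes).** Let `M` be a
discrete `p`-primary `G`-module with continuous action, `I ≤ N ≤ H` subgroups of `G` with `N` compact,
and assume every subgroup of `N` that is open in `N` and contains (the trace of) `I` has index prime to
`p`.  Then a class of `H¹(H, M)` whose restriction to `I` vanishes restricts to zero on `N`.  Proof: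
on an `I`-vanishing representative `f` the zero locus `V ≤ N` is an open subgroup of `p′`-index `m`;
averaging over `N ⧸ V` gives `m·f = -∂S`, and `m` is bijective on the `p`-primary module `M`.
[cite: SerreGaloisCohomology1997, I.§2.4 (Cor. of Prop. 9: `res`/`cor`, `[G:H]` kills the kernel)]
[cite: NeukirchSchmidtWingberg2008, (1.6.1)] -/
theorem resOfLe_eq_zero_of_resOfLe_eq_zero_of_coprime_index {p : ℕ}
    {H N I : Subgroup G} (hIN : I ≤ N) (hNH : N ≤ H)
    (hcont : ∀ m : M, Continuous fun g : G ↦ g • m)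
    (hprim : ∀ m : M, ∃ k : ℕ, p ^ k • m = 0)
    (hNc : IsCompact (N : Set G))
    (hP : ∀ V : Subgroup N, IsOpen (V : Set N) → (∀ x : N, (x : G) ∈ I → x ∈ V) →
      V.index.Coprime p)
    (c : subgroupH1 H M) (hc : resOfLe M (hIN.trans hNH) c = 0) :
    resOfLe M hNH c = 0 := by
  obtain ⟨z, rfl⟩ := oneCocycleClass_surjective _ c
  rw [CocycleCriteria.resOfLe_oneCocycleClass_eq_zero_iff] at hc ⊢
  obtain ⟨a, ha⟩ := hc
  -- the representative `f = z - ∂a` on `N`, vanishing on `I`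
  obtain ⟨f, hf⟩ : ∃ f : N → M, ∀ x, f x = z.1 (Subgroup.inclusion hNH x) - ((x : G) • a - a) :=
    ⟨_, fun _ ↦ rfl⟩
  have hz_mul : ∀ x y : N, z.1 (Subgroup.inclusion hNH (x * y)) =
      z.1 (Subgroup.inclusion hNH x) + (x : G) • z.1 (Subgroup.inclusion hNH y) := fun x y ↦ by
    rw [map_mul]; exact z.2 _ _
  have hf_mul : ∀ x y : N, f (x * y) = f x + (x : G) • f y := fun x y ↦ by
    simp only [hf, hz_mul, Subgroup.coe_mul, mul_smul, smul_sub]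
    abel
  have hf_one : f 1 = 0 := by
    have h1 : z.1 1 = 0 := contOneCocycles.apply_one z
    rw [hf, map_one, h1, Subgroup.coe_one, one_smul, sub_self, sub_zero]
  have hf_I : ∀ x : N, (x : G) ∈ I → f x = 0 := fun x hx ↦ by
    have h := ha ⟨x, hx⟩
    have e : Subgroup.inclusion (hIN.trans hNH) ⟨(x : G), hx⟩ = Subgroup.inclusion hNH x := rfl
    rw [hf, ← e, h]
    exact sub_self _
  have hf_cont : Continuous f := by
    have e : f = fun x ↦ z.1 (Subgroup.inclusion hNH x) - ((x : G) • a - a) := funext hf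
    rw [e]
    exact (z.1.continuous.comp (continuous_inclusion hNH)).sub
      (((hcont a).comp continuous_subtype_val).sub continuous_const)
  -- the zero locus of `f`: an open subgroup `V ≤ N` containing the trace of `I`
  let V : Subgroup N :=
    { carrier := {x | f x = 0}
      one_mem' := hf_one
      mul_mem' := fun {x y} hx hy ↦ by
        change f x = 0 at hx; change f y = 0 at hy; change f (x * y) = 0
        rw [hf_mul, hx, hy, smul_zero, add_zero]
      inv_mem' := fun {x} hx ↦ by
        change f x = 0 at hx; change f x⁻¹ = 0
        have h := hf_mul x x⁻¹
        rw [mul_inv_cancel, hf_one, hx, zero_add] at h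
        have h' := congrArg (fun m ↦ (x : G)⁻¹ • m) h
        simp only [smul_zero, smul_smul, inv_mul_cancel, one_smul] at h'
        exact h'.symm }
  have hVmem : ∀ x : N, x ∈ V ↔ f x = 0 := fun x ↦ Iff.rfl
  have hVopen : IsOpen (V : Set N) := (isOpen_discrete ({0} : Set M)).preimage hf_cont
  have hm : V.index.Coprime p := hP V hVopen fun x hx ↦ (hVmem x).2 (hf_I x hx)
  haveI : CompactSpace N := isCompact_iff_compactSpace.mp hNc
  haveI : Finite (N ⧸ V) := Subgroup.quotient_finite_of_isOpen V hVopen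
  haveI : Fintype (N ⧸ V) := Fintype.ofFinite _
  -- `f` is constant on left cosets of `V`
  have hf_const : ∀ x y : N, (QuotientGroup.mk x : N ⧸ V) = QuotientGroup.mk y → f x = f y := by
    intro x y hxy
    rw [QuotientGroup.eq] at hxy
    have h := hf_mul x (x⁻¹ * y)
    rw [mul_inv_cancel_left, (hVmem _).1 hxy, smul_zero, add_zero] at h
    exact h.symm
  have hout : ∀ x : N, f (QuotientGroup.mk x : N ⧸ V).out = f x := fun x ↦
    hf_const _ _ (QuotientGroup.out_eq' _)
  -- averaging: `S = Σ_{q ∈ N/V} f(q)` satisfies `S = m·f(g) + g·S`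
  obtain ⟨S, hS⟩ : ∃ S : M, S = ∑ q : N ⧸ V, f q.out := ⟨_, rfl⟩
  have hsum : ∀ g : N, S = V.index • f g + (g : G) • S := by
    intro g
    have h1 : ∑ q : N ⧸ V, f (Quotient.out (g • q : N ⧸ V)) = S := by
      rw [hS]
      exact Fintype.sum_equiv (MulAction.toPerm g) (fun q : N ⧸ V ↦ f (Quotient.out (g • q : N ⧸ V)))
        (fun q : N ⧸ V ↦ f q.out) fun _ ↦ rfl
    have h2 : ∀ q : N ⧸ V, f (Quotient.out (g • q : N ⧸ V)) = f g + (g : G) • f q.out := fun q ↦ by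
      have e : (g • q : N ⧸ V) = QuotientGroup.mk (g * q.out) := by
        conv_lhs => rw [← QuotientGroup.out_eq' q]
        rfl
      rw [e, hout, hf_mul]
    simp_rw [h2] at h1
    rw [Finset.sum_add_distrib, Finset.sum_const, ← Finset.smul_sum, Finset.card_univ,
      ← Nat.card_eq_fintype_card, ← hS] at h1
    rw [Subgroup.index]
    exact h1.symm
  -- divide `S` by `m` and conclude `f = ∂(-S')`
  obtain ⟨S', hS'⟩ := exists_nsmul_eq_of_coprime hm S (hprim S)
  have hfS : ∀ g : N, f g = (g : G) • (-S') - (-S') := by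
    intro g
    have hgS : (g : G) • (V.index • S') = V.index • ((g : G) • S') :=
      map_nsmul (DistribSMul.toAddMonoidHom M (g : G)) V.index S'
    have h3 : V.index • f g = S - (g : G) • S := eq_sub_of_add_eq (hsum g).symm
    have h0 : V.index • (f g + ((g : G) • S' - S')) = 0 := by
      rw [smul_add, smul_sub, ← hgS, hS', h3]; abel
    have h1 : f g + ((g : G) • S' - S') = 0 :=
      eq_zero_of_coprime_nsmul_eq_zero hm (hprim _) h0
    rw [smul_neg, sub_neg_eq_add, ← sub_eq_zero, ← h1]
    abel
  refine ⟨a - S', fun x ↦ ?_⟩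
  have hx : z.1 (Subgroup.inclusion hNH x) = f x + ((x : G) • a - a) := by
    rw [hf]; abel
  rw [hx, hfS, smul_sub, smul_neg]
  abel

end Key

end Summit.BirchSwinnertonDyer.BirchSwinnertonDyer.Theorems.ProPrimeToPVanishing

end
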